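import Summits.QuantumFields.BalabanUV.T4Continuum.Support.MinimalActionExistence
import Summits.QuantumFields.BalabanUV.T4Continuum.Support.MinimalActionCapstone
import Summits.QuantumFields.BalabanUV.T4Continuum.Support.LevelZeroRegular
import HarnessLib

/-!
# T⁴ programme, node NE3 (η-rate of the minimisers) — THE ACTION SANDWICH, supplier A-H1-cpt, part 3:
# THE OWNER's CAPSTONE (43S) WITHOUT (H1), AND WITHOUT (H0) ON THE SMALL-FIELD DATA CLASS

NE3 formalisation swarm `b2b-balaban-t4-ne3-formalise-*` of the cell `pub-balaban`, unit `b2b-balaban-t4-ne3-formalise-leaf-05`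
(gen 2), supplier row «A-H1-cpt» of `t4/formal/NE3/LEAVES.md` v1.3 — part 3, requested by the row owner (journal
2026-08-20T08:03:37Z ENDORSE «A-H1-cpt» (3): «the h1-free ENDs `actionRate_sfClass_of_approxRefine'` ∕
`exists_tendsto_minAct_of_approxRefine'` … and with `LevelZeroRegular` the (H0) binder also goes for `dom ⊆ sfClass d L N ε 0`»).
Parts 1–2 (`MinimalActionCompact` p212011, `MinimalActionExistence` p212157) made leaf A-H1 KERNEL modulo (H2):
`exists_isMinimiser_of_smoothRefine`.  Here, by composition only:
§1 `exists_regular_isMinimiser_of_smoothRefine` — the owner's existential reading (H∃) «for every `k` SOME minimiser of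
   run `k` has sup-form regularity `(b, c)`» from (H0) + (H3ˢᵘᵖ) + `SmoothRefine`;
§2 **`exists_tendsto_minAct_of_approxRefine_cpt`** and **`actionHalf_of_approxRefine_cpt`** = the owner's
   `MinimalActionCapstone.exists_tendsto_minAct_of_approxRefine` ∕ `actionHalf_of_approxRefine` (p212069) with the
   binder (H1) DELETED (extra binders: the class-radius regime `16·C₀·ε ≤ 3`, `1024(d+1)(d+4)L²ε ≤ 1` of part 1);
§3 **`actionHalf_of_approxRefine_sfClass₀`** ∕ **`exists_tendsto_minAct_of_approxRefine_sfClass₀`**: for data in the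
   small-field class `sfClass d L N ε₁ 0` (B11's class (7)) with `ε₁ ≤ 1/4`, `ε₁ ≤ b`, `4ε₁ ≤ c`, the binder (H0) is
   discharged too (`LevelZeroRegular.regularSup_zero_of_sfClass_le`, p211829): **route (A)'s action half ⇐ (H3ˢᵘᵖ)
   [B11 Thm 1 (8)+(9)_{β=1} TYPE regularity of the `sfClass`-minimisers] + `ApproxRefine` [leaf R1, crew] + explicit
   numerics, NOTHING ELSE.**

HONEST FRAMING.  Composition of landed theorems; finite-T⁴ bookkeeping about MINIMISERS (rung (B)+1: the finite-torus
continuum limit of gauge-invariant observables — NOT infinite volume, NO mass gap, NOT the Clay problem, NOT summit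
progress).  **NE3 is NOT proved**: (H3ˢᵘᵖ) and `ApproxRefine` remain hypothesis SHAPES asserted for nothing; the LOCAL half
of `T4EtaRateMin.NE3Shape` (readings (D)∕(F)) is untouched.  No conditional of the cell (`BetaPertH`, (B), G-an2-4)
occurs; nothing printed is a hypothesis; every shape imported BY NAME; no `def`, no `sorry`.  Context: T. Bałaban, Commun.
Math. Phys. **102** (1985) 277–309 [Balaban1985Variational] (5)–(8) p. 278, Thm 1 p. 279.  PLACEMENT:
`Summits/QuantumFields/BalabanUV/` (human rule 2026-08-19).  Record: `t4/formal/NE3/LEAVES.md` row A-H1-cpt.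
HONEST DEPENDENCY: continuum YM on T⁴ ⇐ BetaPertH ∧ nine spine estimates (0/9 proved); BetaPertH ⇐ (D1) ∧ (D4) ∧ CAP+tail;
G-an2-4 gates asym, D1 and NE2/3/4.
-/

set_option autoImplicit false

open scoped BigOperators Matrix Matrix.Norms.L2Operator Topology
open NormedSpace Filter

namespace Summit.QuantumFields.BalabanUV.T4Continuum.MinimalActionExistenceCapstone

open Literature.MathematicalPhysics.QuantumFieldTheory.Balaban1983to89
open B7Prop1Explicit B7Prop2Explicit
open T4AveragingDeficitWall hiding Site Plane Plaq Bond
open T4AveragingDeficitNonAbelian (wallConstNA)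
open T4EtaRateMin (ActionRate)
open MinimalActionSandwich MinimalActionRate MinimalActionRefine MinimalActionLimit SmoothRefineOfApprox ChainEndFix
open MinimalActionExistence MinimalActionCapstone LevelZeroRegular

noncomputable section

variable {d : ℕ} {n : Type*} [Fintype n] [DecidableEq n] [Nonempty n]

/-! ## §1 The existential reading (H∃): some regular minimiser at every level -/

/-- **(H∃) FROM (H0) + (H3ˢᵘᵖ) + THE KINEMATIC LEMMA**: for every `k` there is a minimiser of run `k` WITH sup-form regularity
`(b, c)` (at `k = 0` the datum; at `k+1` the minimiser of part 2's `exists_isMinimiser_of_smoothRefine`, regular by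
(H3ˢᵘᵖ)). [folklore] -/
theorem exists_regular_isMinimiser_of_smoothRefine {L N : ℕ} (hL : 2 ≤ L) {b c b' c' ε : ℝ} (hbε : b ≤ ε)
    (hε0 : 0 ≤ ε) (hε1 : 16 * C0 d * ε ≤ 3) (hε2 : 1024 * (d + 1) * (d + 4) * (L : ℝ) ^ 2 * ε ≤ 1)
    {V : Site d → Fin d → (Matrix n n ℂ)ˣ}
    (h3 : ∀ (k : ℕ) (U : Site d → Fin d → (Matrix n n ℂ)ˣ),
      IsMinimiser d (sfClass d L N ε) L N (k + 1) V U → RegularSup d L N b c (k + 1) U)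
    (h0 : RegularSup d L N b c 0 V) (hR : SmoothRefine d (sfClass (n := n) d L N ε) L N b c b' c') (k : ℕ) :
    ∃ U, IsMinimiser d (sfClass d L N ε) L N k V U ∧ RegularSup d L N b c k U := by
  obtain ⟨U, hU⟩ := exists_isMinimiser_of_smoothRefine hL hbε hε0 hε1 hε2 h3 h0 hR k
  cases k with
  | zero => exact ⟨U, hU, regularSup_of_isMinimiser_zero h0 hU⟩
  | succ k => exact ⟨U, hU, h3 k U hU⟩

/-! ## §2 The capstone without (H1) -/

/-- **`MinimalActionCapstone.exists_tendsto_minAct_of_approxRefine` WITHOUT (H1)**: the minimal actions converge with the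
geometric tail `[wallConstNA(d,L)(gradConst d (max c c′) + (max b b′)³)/L²]·N^d·(L⁻²)^k/(1 − L⁻²)` from (H3ˢᵘᵖ) + (H0) +
`ApproxRefine` (+ explicit numerics; `L ≥ 2`). [folklore] -/
theorem exists_tendsto_minAct_of_approxRefine_cpt {L N : ℕ} (hL : 2 ≤ L) (hN : 1 ≤ N) {b c b₁ c₁ m ε : ℝ}
    (hb : 0 ≤ b) (hb₁ : 0 ≤ b₁) (hm : 0 ≤ m)
    (hBs : 512 * (d + 1) * (d + 4) * (L : ℝ) ^ 2 * max b (b₁ + 8 * m * (L : ℝ) ^ 3 / gap d L) ≤ 1)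
    (hbε : b + 226 * (8 * (d + 1) * (d + 4)) ^ 2 * b ^ 2 ≤ ε)
    (hbs₁ : 512 * (d + 1) * (d + 4) * (L : ℝ) ^ 2 * b₁ ≤ 1)
    (hgap : 4 * (2 * (8 * (d + 1) * (d + 4) * (L : ℝ) ^ 2 * b₁) + 2 * m / gap d L) ≤ gap d L)
    (hhalf : b₁ + 8 * m / gap d L ≤ 1 / 2) (hε : b₁ + 8 * m * (L : ℝ) ^ 3 / gap d L ≤ ε)
    (hε1 : 16 * C0 d * ε ≤ 3) (hε2 : 1024 * (d + 1) * (d + 4) * (L : ℝ) ^ 2 * ε ≤ 1)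
    {V : Site d → Fin d → (Matrix n n ℂ)ˣ}
    (h3 : ∀ (k : ℕ) (U : Site d → Fin d → (Matrix n n ℂ)ˣ),
      IsMinimiser d (sfClass d L N ε) L N (k + 1) V U → RegularSup d L N b c (k + 1) U)
    (h0 : RegularSup d L N b c 0 V)
    (hA : ApproxRefine d (sfClass (n := n) d L N ε) L N b c b₁ c₁ m) :
    ∃ A : ℝ, Tendsto (fun k => minAct d (sfClass d L N ε) L N k V) atTop (𝓝 A) ∧
      ∀ k : ℕ, |minAct d (sfClass d L N ε) L N k V - A|
        ≤ wallConstNA d L * (gradConst d (max c (c₁ + 36 * m * (L : ℝ) ^ 3 / gap d L))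
            + (max b (b₁ + 8 * m * (L : ℝ) ^ 3 / gap d L)) ^ 3) / (L : ℝ) ^ 2 * (N : ℝ) ^ d
            * (((L : ℝ) ^ 2)⁻¹) ^ k / (1 - ((L : ℝ) ^ 2)⁻¹) := by
  have hbε' : b ≤ ε := by nlinarith
  exact exists_tendsto_minAct_of_approxRefine hL hN hb hb₁ hm hBs hbε hbs₁ hgap hhalf hε
    (exists_isMinimiser_of_smoothRefine hL hbε' (hb.trans hbε') hε1 hε2 h3 h0
      (smoothRefine_of_approxRefine (by omega) hb₁ hm hbs₁ hgap hhalf hε hA)) h3 h0 hA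

/-- **`MinimalActionCapstone.actionHalf_of_approxRefine` WITHOUT (H1)**: `0 ≤ L⁻² < 1` and
`ActionRate (minActReadings (sfClass …) … dom loc) (…) (L⁻²)` on every `dom` of data satisfying (H3ˢᵘᵖ) and (H0), given
`ApproxRefine` (+ explicit numerics). [folklore] -/
theorem actionHalf_of_approxRefine_cpt {L N : ℕ} (hL : 2 ≤ L) (hN : 1 ≤ N) {b c b₁ c₁ m ε : ℝ} (hb : 0 ≤ b)
    (hb₁ : 0 ≤ b₁) (hm : 0 ≤ m)
    (hBs : 512 * (d + 1) * (d + 4) * (L : ℝ) ^ 2 * max b (b₁ + 8 * m * (L : ℝ) ^ 3 / gap d L) ≤ 1)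
    (hbε : b + 226 * (8 * (d + 1) * (d + 4)) ^ 2 * b ^ 2 ≤ ε)
    (hbs₁ : 512 * (d + 1) * (d + 4) * (L : ℝ) ^ 2 * b₁ ≤ 1)
    (hgap : 4 * (2 * (8 * (d + 1) * (d + 4) * (L : ℝ) ^ 2 * b₁) + 2 * m / gap d L) ≤ gap d L)
    (hhalf : b₁ + 8 * m / gap d L ≤ 1 / 2) (hε : b₁ + 8 * m * (L : ℝ) ^ 3 / gap d L ≤ ε)
    (hε1 : 16 * C0 d * ε ≤ 3) (hε2 : 1024 * (d + 1) * (d + 4) * (L : ℝ) ^ 2 * ε ≤ 1)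
    {dom : Set (Site d → Fin d → (Matrix n n ℂ)ˣ)}
    (h3 : ∀ V ∈ dom, ∀ (k : ℕ) (U : Site d → Fin d → (Matrix n n ℂ)ˣ),
      IsMinimiser d (sfClass d L N ε) L N (k + 1) V U → RegularSup d L N b c (k + 1) U)
    (h0 : ∀ V ∈ dom, RegularSup d L N b c 0 V)
    (hA : ApproxRefine d (sfClass (n := n) d L N ε) L N b c b₁ c₁ m)
    {X : Type*} (loc : ℕ → (Site d → Fin d → (Matrix n n ℂ)ˣ) → X → ℝ) :
    0 ≤ ((L : ℝ) ^ 2)⁻¹ ∧ ((L : ℝ) ^ 2)⁻¹ < 1 ∧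
      ActionRate (minActReadings d (sfClass d L N ε) L N dom loc)
        (wallConstNA d L * (gradConst d (max c (c₁ + 36 * m * (L : ℝ) ^ 3 / gap d L))
          + (max b (b₁ + 8 * m * (L : ℝ) ^ 3 / gap d L)) ^ 3) / (L : ℝ) ^ 2) (((L : ℝ) ^ 2)⁻¹) :=
  ⟨(rate_lt_one hL).1, (rate_lt_one hL).2,
    actionRate_sfClass_of_approxRefine_cpt hL hN hb hb₁ hm hBs hbε hbs₁ hgap hhalf hε hε1 hε2 h3 h0 hA loc⟩

/-! ## §3 Data in the small-field class (7): (H0) discharged as well -/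

/-- **ROUTE (A)'s ACTION HALF FROM (H3ˢᵘᵖ) + `ApproxRefine` ALONE, for data in B11's class (7)**: on every
`dom ⊆ sfClass d L N ε₁ 0` (unitary, `N`-periodic, `|V(∂p) − 1| ≤ ε₁`) with `ε₁ ≤ 1/4`, `ε₁ ≤ b`, `4ε₁ ≤ c`, the binders
(H1) (parts 1–2) and (H0) (`LevelZeroRegular.regularSup_zero_of_sfClass_le`) are theorems, so `0 ≤ L⁻² < 1` and
`ActionRate (minActReadings (sfClass d L N ε) …) (…) (L⁻²)` follow from (H3ˢᵘᵖ) — sup-form regularity `(b, c)` of the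
`sfClass`-minimisers of runs `k+1` (B11 Thm 1 (8)+(9)_{β=1} TYPE) — and `ApproxRefine` (leaf R1), plus explicit numerics.
NE3 is NOT proved: (H3ˢᵘᵖ) and `ApproxRefine` are hypotheses; the local half is untouched. [folklore] -/
theorem actionHalf_of_approxRefine_sfClass₀ {L N : ℕ} (hL : 2 ≤ L) (hN : 1 ≤ N) {b c b₁ c₁ m ε ε₁ : ℝ} (hb : 0 ≤ b)
    (hb₁ : 0 ≤ b₁) (hm : 0 ≤ m)
    (hBs : 512 * (d + 1) * (d + 4) * (L : ℝ) ^ 2 * max b (b₁ + 8 * m * (L : ℝ) ^ 3 / gap d L) ≤ 1)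
    (hbε : b + 226 * (8 * (d + 1) * (d + 4)) ^ 2 * b ^ 2 ≤ ε)
    (hbs₁ : 512 * (d + 1) * (d + 4) * (L : ℝ) ^ 2 * b₁ ≤ 1)
    (hgap : 4 * (2 * (8 * (d + 1) * (d + 4) * (L : ℝ) ^ 2 * b₁) + 2 * m / gap d L) ≤ gap d L)
    (hhalf : b₁ + 8 * m / gap d L ≤ 1 / 2) (hε : b₁ + 8 * m * (L : ℝ) ^ 3 / gap d L ≤ ε)
    (hε1 : 16 * C0 d * ε ≤ 3) (hε2 : 1024 * (d + 1) * (d + 4) * (L : ℝ) ^ 2 * ε ≤ 1)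
    (hε₁ : ε₁ ≤ 1 / 4) (hε₁b : ε₁ ≤ b) (hε₁c : 4 * ε₁ ≤ c)
    {dom : Set (Site d → Fin d → (Matrix n n ℂ)ˣ)} (hdom : dom ⊆ sfClass d L N ε₁ 0)
    (h3 : ∀ V ∈ dom, ∀ (k : ℕ) (U : Site d → Fin d → (Matrix n n ℂ)ˣ),
      IsMinimiser d (sfClass d L N ε) L N (k + 1) V U → RegularSup d L N b c (k + 1) U)
    (hA : ApproxRefine d (sfClass (n := n) d L N ε) L N b c b₁ c₁ m)
    {X : Type*} (loc : ℕ → (Site d → Fin d → (Matrix n n ℂ)ˣ) → X → ℝ) :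
    0 ≤ ((L : ℝ) ^ 2)⁻¹ ∧ ((L : ℝ) ^ 2)⁻¹ < 1 ∧
      ActionRate (minActReadings d (sfClass d L N ε) L N dom loc)
        (wallConstNA d L * (gradConst d (max c (c₁ + 36 * m * (L : ℝ) ^ 3 / gap d L))
          + (max b (b₁ + 8 * m * (L : ℝ) ^ 3 / gap d L)) ^ 3) / (L : ℝ) ^ 2) (((L : ℝ) ^ 2)⁻¹) :=
  actionHalf_of_approxRefine_cpt hL hN hb hb₁ hm hBs hbε hbs₁ hgap hhalf hε hε1 hε2 h3
    (fun _ hV => regularSup_zero_of_sfClass_le hε₁ hε₁b hε₁c (hdom hV)) hA loc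

/-- The same for the LIMIT with geometric tail: `A_k(V) → A(V)` for every datum `V ∈ sfClass d L N ε₁ 0`, from (H3ˢᵘᵖ) +
`ApproxRefine` alone (+ explicit numerics). [folklore] -/
theorem exists_tendsto_minAct_of_approxRefine_sfClass₀ {L N : ℕ} (hL : 2 ≤ L) (hN : 1 ≤ N)
    {b c b₁ c₁ m ε ε₁ : ℝ} (hb : 0 ≤ b) (hb₁ : 0 ≤ b₁) (hm : 0 ≤ m)
    (hBs : 512 * (d + 1) * (d + 4) * (L : ℝ) ^ 2 * max b (b₁ + 8 * m * (L : ℝ) ^ 3 / gap d L) ≤ 1)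
    (hbε : b + 226 * (8 * (d + 1) * (d + 4)) ^ 2 * b ^ 2 ≤ ε)
    (hbs₁ : 512 * (d + 1) * (d + 4) * (L : ℝ) ^ 2 * b₁ ≤ 1)
    (hgap : 4 * (2 * (8 * (d + 1) * (d + 4) * (L : ℝ) ^ 2 * b₁) + 2 * m / gap d L) ≤ gap d L)
    (hhalf : b₁ + 8 * m / gap d L ≤ 1 / 2) (hε : b₁ + 8 * m * (L : ℝ) ^ 3 / gap d L ≤ ε)
    (hε1 : 16 * C0 d * ε ≤ 3) (hε2 : 1024 * (d + 1) * (d + 4) * (L : ℝ) ^ 2 * ε ≤ 1)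
    (hε₁ : ε₁ ≤ 1 / 4) (hε₁b : ε₁ ≤ b) (hε₁c : 4 * ε₁ ≤ c)
    {V : Site d → Fin d → (Matrix n n ℂ)ˣ} (hV : V ∈ sfClass d L N ε₁ 0)
    (h3 : ∀ (k : ℕ) (U : Site d → Fin d → (Matrix n n ℂ)ˣ),
      IsMinimiser d (sfClass d L N ε) L N (k + 1) V U → RegularSup d L N b c (k + 1) U)
    (hA : ApproxRefine d (sfClass (n := n) d L N ε) L N b c b₁ c₁ m) :
    ∃ A : ℝ, Tendsto (fun k => minAct d (sfClass d L N ε) L N k V) atTop (𝓝 A) ∧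
      ∀ k : ℕ, |minAct d (sfClass d L N ε) L N k V - A|
        ≤ wallConstNA d L * (gradConst d (max c (c₁ + 36 * m * (L : ℝ) ^ 3 / gap d L))
            + (max b (b₁ + 8 * m * (L : ℝ) ^ 3 / gap d L)) ^ 3) / (L : ℝ) ^ 2 * (N : ℝ) ^ d
            * (((L : ℝ) ^ 2)⁻¹) ^ k / (1 - ((L : ℝ) ^ 2)⁻¹) :=
  exists_tendsto_minAct_of_approxRefine_cpt hL hN hb hb₁ hm hBs hbε hbs₁ hgap hhalf hε hε1 hε2 h3
    (regularSup_zero_of_sfClass_le hε₁ hε₁b hε₁c hV) hA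

end

end Summit.QuantumFields.BalabanUV.T4Continuum.MinimalActionExistenceCapstone
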